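import Summits.BirchSwinnertonDyer.BirchSwinnertonDyer.Theorems.PrintCf2SplitBadTwoLineLocalDefectVbarFrameOdd
import HarnessLib

/-!
# Road α, crux `PrintCf2.SplitBadTwoRankOneOfFacts` (stmt-BirchSwinnertonDyer-20368), stub S3d — the LOCAL DEFECT GROUP `Def(v̄)` AT THE CHOSEN PLACE,
# as a subgroup of the local cohomology `H¹(ker κ′ ⊓ D_v̄, W*)`, and its VANISHING on the class `d ≡ 7 (mod 8)` (local form of p687817/p688903)

Cell `bsd-print-cf2`, width seat `bsd-line-cf2-p1-w6` g4 (S3d: «𝓗 local + ch(𝓗^∨)(0) per class», LEAD 02:30:44Z ownership map); `--supports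
stmt-BirchSwinnertonDyer-20368 --as helper`. HONEST FRAMING: nothing here closes the crux or a registered stub; no summit statement is proved by this
seat; BSD is not proved by any of this. No definition, no named fact, no `sorry`.

THE LOCAL OBJECT (for -w7 g5's (LS) surjectivity, -w8 g4's σ-bookkeeping, -w3 g11's spine): at the CHOSEN place above `v̄` of the line `K*_∞ = K̄^{ker κ′}`, the
summand of `𝓗 = ⊕_{𝔓 ∣ v̄} H¹_nr/H¹_str((K*_∞)_𝔓, W*)` is the subgroup of UNRAMIFIED LOCAL CLASSES
  `Def(κ′, M, v̄) := (resOfLe M (inf_le_inf_left κ′.kerSubgroup (inertia_le_decomp v̄) : ker κ′ ⊓ I_v̄ ≤ ker κ′ ⊓ D_v̄)).ker ≤ H¹(ker κ′ ⊓ D_v̄, M)`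
(the strict local condition is «class = 0», so no quotient is needed). This file:
* **`localDefect_eq_bot_of_mover`** (generic; `κ` ramified at `w`, sign module `M` with open stabilisers, `2`-divisible, one element of order `2`, `ker κ ⊓ I_w`
  acting trivially, a mover in `ker κ ⊓ D_w`): `Def = ⊥` — every LOCAL class on `ker κ ⊓ D_w` dying on `ker κ ⊓ I_w` is zero (file 1 `exists_eq_smul_sub_of_mover`
  on `H_F = res⁻¹(ker κ)`, pulled back along the surjection `H_F ↠ ker κ ⊓ D_w`; files 2–3 for (U′), commutators, openness).
* **`localDefect_vbar_eq_bot_of_frame`** (road α, `d ≡ 7 (mod 8)`): `Def(κ′, W*, v̄) = ⊥` — the summand of `𝓗` at every place above `v̄` VANISHES, so `𝓗 = 0` and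
  `e_δ(1,7) = 0` whatever the index set of places is.

presearch: Greenberg LNM 1716 §3; Rubin LNM 1716 §3 Lemma 3.6 (ii); Greenberg–Vatsal 2000 §2 p. 17 — held; no new fact. beyond-print theorem: no.

References: [GreenbergLNM1716] §3; [Rubin1999] §3 Lemma 3.6 (ii); [GreenbergVatsal2000] §2 pp. 17–21; [Agboola2007] §3 Prop. 3.2.
-/

set_option autoImplicit false
set_option linter.dupNamespace false

noncomputable section

open scoped Classical
open NumberField IsDedekindDomain Field Multiplicative WeierstrassCurve
open Literature.NumberTheory.EllipticCurves Literature.NumberTheory.EllipticCurves.GreenbergSelmer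
open Literature.NumberTheory.GaloisRepresentations Literature.AnabelianGeometry.AbsoluteAnabelian
open Summit.BirchSwinnertonDyer.BirchSwinnertonDyer.Theorems.PrintCf2.AdditiveAtSeven
open Summit.BirchSwinnertonDyer.BirchSwinnertonDyer.Theorems.PrintCf2.CMPrimes
open Summit.BirchSwinnertonDyer.BirchSwinnertonDyer.Theorems.PrintCf2.RestrictedSelmerPair
open Summit.BirchSwinnertonDyer.BirchSwinnertonDyer.Theorems.PrintCf2.SplitPrimeLine

namespace Summit.BirchSwinnertonDyer.BirchSwinnertonDyer.Theorems.PrintCf2.LineLocallyTrivial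

/-! ## §1. Generic: the local defect vanishes for a sign module with a non-inertial mover -/

section Generic

variable {K : Type} [Field K] [NumberField K] {p : ℕ} [Fact p.Prime] (κ : ZpExtension K p)
  {M : Type} [AddCommGroup M] [DistribMulAction (absoluteGaloisGroup K) M] [TopologicalSpace M] [DiscreteTopology M]

/-- **`Def(w) = ⊥` for a sign module with a non-inertial mover** (LOCAL classes): `κ` a `ℤ_p`-line ramified at `w`, `M` discrete with open stabilisers,
`2`-divisible with one element of order `2`, `ker κ` acting by signs, `ker κ ⊓ I_w` trivially, a mover `δ₀ ∈ ker κ ⊓ D_w`; then a class of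
`H¹(ker κ ⊓ D_w, M)` dying on `ker κ ⊓ I_w` is ZERO. [cite: GreenbergLNM1716, §3] [cite: Rubin1999, §3 Lemma 3.6 (ii)] [cite: SerreGaloisCohomology1997, I §2.4] -/
theorem localDefect_eq_bot_of_mover {w : HeightOneSpectrum (𝓞 K)} (hram : ¬ GreenbergSelmer.inertia w ≤ κ.kerSubgroup)
    (hstab : ∀ m : M, IsOpen (MulAction.stabilizer (absoluteGaloisGroup K) m : Set (absoluteGaloisGroup K)))
    (hI : ∀ τ ∈ GreenbergSelmer.inertia w, τ ∈ κ.kerSubgroup → ∀ m : M, τ • m = m)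
    (hpm : ∀ g ∈ κ.kerSubgroup, (∀ m : M, g • m = m) ∨ (∀ m : M, g • m = -m))
    {δ₀ : absoluteGaloisGroup K} (hδD : δ₀ ∈ GreenbergSelmer.decomp w) (hδκ : δ₀ ∈ κ.kerSubgroup) (hδ₀ : ∀ m : M, δ₀ • m = -m)
    (hdiv : ∀ m : M, ∃ m' : M, (2 : ℕ) • m' = m) (h2 : ∀ x y : M, (2 : ℕ) • x = 0 → (2 : ℕ) • y = 0 → x ≠ 0 → y ≠ 0 → x = y) :
    (resOfLe M (inf_le_inf_left κ.kerSubgroup (GreenbergSelmer.inertia_le_decomp w) :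
        κ.kerSubgroup ⊓ GreenbergSelmer.inertia w ≤ κ.kerSubgroup ⊓ GreenbergSelmer.decomp w)).ker = ⊥ := by
  haveI : CompactSpace (absoluteGaloisGroup (w.adicCompletion K)) := absoluteGaloisGroup_compactSpace (w.adicCompletion K)
  rw [eq_bot_iff]
  intro y hy
  rw [AddMonoidHom.mem_ker] at hy
  rw [AddSubgroup.mem_bot]
  set res := absGaloisRestrict K (w.adicCompletion K) with hres
  set HF : Subgroup (absoluteGaloisGroup (w.adicCompletion K)) := κ.kerSubgroup.comap res.toMonoidHom with hHF
  have hmemHF : ∀ s, s ∈ HF ↔ res s ∈ κ.kerSubgroup := fun _ ↦ Iff.rfl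
  have hHFcl : IsClosed ((HF : Subgroup (absoluteGaloisGroup (w.adicCompletion K))) : Set (absoluteGaloisGroup (w.adicCompletion K))) :=
    κ.isClosed_kerSubgroup.preimage res.continuous
  letI : DistribMulAction HF M := DistribMulAction.compHom M (res.toMonoidHom.comp HF.subtype)
  have hsmul : ∀ (s : HF) (m : M), s • m = res (s : absoluteGaloisGroup (w.adicCompletion K)) • m := fun _ _ ↦ rfl
  have hstab' : ∀ m : M, IsOpen (MulAction.stabilizer HF m : Set HF) := by
    intro m
    have : (MulAction.stabilizer HF m : Set HF) =
        (fun s : HF ↦ res (s : absoluteGaloisGroup (w.adicCompletion K))) ⁻¹' (MulAction.stabilizer (absoluteGaloisGroup K) m : Set _) := by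
      ext s
      simp only [SetLike.mem_coe, MulAction.mem_stabilizer_iff, Set.mem_preimage]
      exact Iff.rfl
    rw [this]
    exact (hstab m).preimage (res.continuous.comp continuous_subtype_val)
  let N : Subgroup HF := (galUnr (w.adicCompletion K)).subgroupOf HF
  have hresI : ∀ n : HF, n ∈ N → res (n : absoluteGaloisGroup (w.adicCompletion K)) ∈ GreenbergSelmer.inertia w := by
    intro n hn
    have hn' : (n : absoluteGaloisGroup (w.adicCompletion K)) ∈ absInertia (w.adicCompletion K) := by
      rw [← galUnr_eq_absInertia]; exact Subgroup.mem_subgroupOf.mp hn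
    exact ⟨n, hn', rfl⟩
  have hN : ∀ n ∈ N, ∀ m : M, n • m = m := fun n hn m ↦ by
    rw [hsmul]
    exact hI _ (hresI n hn) n.2 m
  have hcomm : ∀ g h : HF, g * h * g⁻¹ * h⁻¹ ∈ N := fun g h ↦
    Subgroup.mem_subgroupOf.mpr (by simpa only [Subgroup.coe_mul, Subgroup.coe_inv] using commutator_mem_galUnr w (g : _) h)
  have hpm' : ∀ g : HF, (∀ m : M, g • m = m) ∨ (∀ m : M, g • m = -m) := fun g ↦ by
    simp only [hsmul]
    exact hpm _ g.2
  obtain ⟨τ₀, hτ₀⟩ := (GreenbergSelmer.mem_decomp_iff w δ₀).mp hδD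
  have hτ₀H : τ₀ ∈ HF := by rw [hmemHF, hτ₀]; exact hδκ
  have hδ₀' : ∀ m : M, (⟨τ₀, hτ₀H⟩ : HF) • m = -m := fun m ↦ by rw [hsmul]; change res τ₀ • m = -m; rw [hτ₀]; exact hδ₀ m
  have hU : ∀ U₁ U₂ : Subgroup HF, IsOpen (U₁ : Set HF) → IsOpen (U₂ : Set HF) → N ≤ U₁ → N ≤ U₂ → U₁.index = 2 → U₂.index = 2 → U₁ = U₂ :=
    fun U₁ U₂ h₁ h₂ hn₁ hn₂ hi₁ hi₂ ↦
      eq_of_isOpen_of_index_two w HF hHFcl (isOpen_comap_kerSubgroup_sup_galUnr w κ hram) U₁ U₂ h₁ h₂ hn₁ hn₂ hi₁ hi₂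
  -- the local class as a crossed homomorphism on `ker κ ⊓ D_w`, pulled back to `H_F`
  obtain ⟨f, rfl⟩ := oneCocycleClass_surjective _ y
  rw [CocycleCriteria.resOfLe_oneCocycleClass_eq_zero_iff] at hy
  obtain ⟨m₀, hm₀⟩ := hy
  let φ : HF →ₜ* ↥(κ.kerSubgroup ⊓ GreenbergSelmer.decomp w) :=
    ⟨{ toFun := fun s ↦ ⟨res (s : absoluteGaloisGroup (w.adicCompletion K)),
          Subgroup.mem_inf.mpr ⟨s.2, (GreenbergSelmer.mem_decomp_iff w _).mpr ⟨s, rfl⟩⟩⟩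
       map_one' := Subtype.ext (map_one res)
       map_mul' := fun s t ↦ Subtype.ext (map_mul res (s : absoluteGaloisGroup (w.adicCompletion K)) t) },
      (res.continuous.comp continuous_subtype_val).subtype_mk _⟩
  let z : contOneCocycles (discreteTopRep HF M) := contOneCocycles.pullback φ (resHomOfEquivariant φ (AddMonoidHom.id M) fun _ _ ↦ rfl) f
  have hz : ∀ s : HF, z.1 s = f.1 (φ s) := fun _ ↦ rfl
  have hzN : ∀ n ∈ N, z.1 n = n • m₀ - m₀ := by
    intro n hn
    let x : ↥(κ.kerSubgroup ⊓ GreenbergSelmer.inertia w) :=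
      ⟨res (n : absoluteGaloisGroup (w.adicCompletion K)), Subgroup.mem_inf.mpr ⟨n.2, hresI n hn⟩⟩
    have key := hm₀ x
    have hincl : Subgroup.inclusion (inf_le_inf_left κ.kerSubgroup (GreenbergSelmer.inertia_le_decomp w)) x = φ n := Subtype.ext rfl
    rw [hincl] at key
    rw [hz, hsmul]
    exact key
  obtain ⟨n, hn⟩ := exists_eq_smul_sub_of_mover N hN hcomm hpm' hδ₀' hdiv h2 hstab' hU z hzN
  -- conclude: `f` is principal on `ker κ ⊓ D_w = φ(H_F)`
  rw [oneCocycleClass_eq_zero_iff]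
  refine ⟨n, fun x ↦ ?_⟩
  obtain ⟨τ, hτ⟩ := (GreenbergSelmer.mem_decomp_iff w _).mp (Subgroup.mem_inf.mp x.2).2
  have hτH : τ ∈ HF := by rw [hmemHF, hτ]; exact (Subgroup.mem_inf.mp x.2).1
  have h1 := hn ⟨τ, hτH⟩
  rw [hz, hsmul] at h1
  have hx : x = φ ⟨τ, hτH⟩ := Subtype.ext hτ.symm
  rw [hx, h1]
  change res τ • n - n = ((φ ⟨τ, hτH⟩ : ↥(κ.kerSubgroup ⊓ GreenbergSelmer.decomp w)) : absoluteGaloisGroup K) • n - n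
  rfl

end Generic

/-! ## §2. Road α, `d ≡ 7 (mod 8)`: the summand of `𝓗` at every place above `v̄` vanishes -/

section Frame

variable {K : Type} [Field K] [NumberField K]

/-- **`Def(κ′, W*, v̄) = ⊥` on the frames with `d ≡ 7 (mod 8)`**: every LOCAL class of `H¹(ker κ′ ⊓ D_v̄, W*)` unramified (dying on `ker κ′ ⊓ I_v̄`) is zero —
the local term of `𝓗 = ⊕_{𝔓 ∣ v̄} H¹_nr/H¹_str((K*_∞)_𝔓, W*)` at the chosen place (and, by conjugation, at every place above `v̄`) VANISHES; inputs as in p688903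
(ramification -w5 g4, signs (C3), inertial triviality, mover from B15, divisibility). [cite: GreenbergLNM1716, §3] [cite: Rubin1999, §3 Lemma 3.6 (ii) and Cor. 3.17]
[cite: GreenbergVatsal2000, §2 pp. 17–21] -/
theorem localDefect_vbar_eq_bot_of_frame {d : ℤ} (hd0 : d ≠ 0) (hd8 : d % 8 = 7)
    (W : WeierstrassCurve ℚ) [W.IsElliptic] (C : VariableChange ℚ) (hC : C • W = cm7.quadraticTwist (d : ℚ)) (hK : IsImaginaryQuadratic K)
    (v vbar : HeightOneSpectrum (𝓞 K)) (hv : ((2 : ℕ) : 𝓞 K) ∈ v.asIdeal) (hvbar : ((2 : ℕ) : 𝓞 K) ∈ vbar.asIdeal) (hne : vbar ≠ v)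
    (π : (W.baseChange K).endRing) (hrel : (π : AddMonoid.End (W.baseChange K).geomPoints) * π = π - 2) {r : ℤ_[2]} (hr : r * r = r - 2)
    (hpin : ∀ τ ∈ GreenbergSelmer.inertia v, ∀ x : ↥((W.baseChange K).endEigenPrimaryTorsion 2 π r), τ • x = x ∨ τ • x = -x)
    (κ' : ZpExtension K 2) (hκ' : κ'.IsUnramifiedOutside vbar) :
    (resOfLe ↥((W.baseChange K).endEigenPrimaryTorsion 2 π r)
        (inf_le_inf_left κ'.kerSubgroup (GreenbergSelmer.inertia_le_decomp vbar) :
          κ'.kerSubgroup ⊓ GreenbergSelmer.inertia vbar ≤ κ'.kerSubgroup ⊓ GreenbergSelmer.decomp vbar)).ker = ⊥ := by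
  haveI : Fact (Nat.Prime 2) := ⟨Nat.prime_two⟩
  have hj : W.j = -3375 := j_eq_of_smul_eq_cm7Twist hd0 W C hC
  obtain ⟨θ, hθ⟩ := exists_sq_eq_neg_seven_of_cmEndo_mem_endRing W K hj π hrel
  have hd4 : d % 4 = 3 := by omega
  have hram : ¬ GreenbergSelmer.inertia vbar ≤ κ'.kerSubgroup := by
    have h := inertia_not_le_kerSubgroup_of_isUnramifiedOutside (p := 2) hK hκ' (adicCompletionPrime_mem_primesAbove K vbar)
    rwa [inertia_adicCompletionPrime_eq_map_absInertia K vbar] at h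
  obtain ⟨δ₀, hδD, hδκ, hδ₀⟩ := exists_mover_vbar_of_frame hd0 hd8 W C hC hK v vbar hv hvbar hne π hrel hr hpin κ' hκ'
  exact localDefect_eq_bot_of_mover κ' hram (isOpen_stabilizer_endEigenPrimaryTorsion _ 2 π r)
    (fun τ hτ hτκ x ↦ smul_eq_self_of_mem_inertia_vbar_of_kerSubgroup_of_frame hd0 hd4 W C hC hK v vbar hv hvbar hne π hrel hr hpin κ' hκ' hτ hτκ x)
    (fun g hg ↦ (mem_kerSubgroup_iff_smul_of_frame hd0 W C hC hK v vbar hv hvbar hne π hrel hr hpin κ' hκ' g).mp hg)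
    hδD hδκ hδ₀ (two_divisible_endEigenPrimaryTorsion W hj hθ π hrel hr) (eq_of_two_nsmul_eq_zero_endEigenPrimaryTorsion W hj hθ π hrel hr)

end Frame

end Summit.BirchSwinnertonDyer.BirchSwinnertonDyer.Theorems.PrintCf2.LineLocallyTrivial

end
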